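import Mathlib
import HarnessLib
import HarnessLib.Audit
import Summits.SmoothPoincare4.Statement
import Literature.Geometry.Lorentzian.LeviCivita
import Literature.Geometry.Lorentzian.Volume
import Literature.Topology.FourManifolds.HomotopyS4CompactProofs
import Literature.Topology.FourManifolds.Cobordism
import Literature.Geometry.Riemannian.AdmissibleFillIn
import Literature.Topology.FourManifolds.ClosedBall
import Literature.Geometry.Riemannian.VolumeSphereTheoremGHDecomposition
import HarnessLib.Audit.Status.Attr

/-!
Route: RicciFat

DORMANT since 2026-08-23T10:36:41Z (reconciler: no traction for 6.1 d (last activity statement-checked at 2026-08-17T08:20:21Z); parked, not closed — `ledger route dormant route-SmoothPoincare4-RicciFat --off` to reactivate) — unstaffed, not closed; items shared with open routes are served there. `ledger route dormant <id> --off` reactivates.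

# Route RicciFat — Ricci-fat homotopy 4-spheres — SPC4 as volume attainment under Ric ≥ 3,
recognised by Cheeger–Colding

It suffices to show X = RICCI-FAT SPHERES (card ricci-fat-homotopy-balls, item 1): every closed
smooth 4-manifold M homotopy
equivalent to S⁴ carries, for every δ > 0, a C^∞ Riemannian metric h with Ric_h ≥ 3h and Vol(M, h) ≥
(1 − δ)·8π²/3
(i.e. V(M) := sup{Vol : Ric ≥ 3} equals Vol(S⁴) = 8π²/3). Cheeger–Colding's differentiable
volume-sphere theorem
(CheegerColding1997 Thm A.1.10: Ric ≥ n−1 and Vol ≥ (1−δ(n))Vol(Sⁿ) ⇒ DIFFEOMORPHIC to Sⁿ, filed as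
the first crux
VolumeSphereRecognition) turns X into SPC4; conversely SPC4 ⇒ X by the round metric, so X ⇔ SPC4
modulo a 1997 theorem:
"an exotic 4-sphere is Ricci-thin in every metric". Two further cruxes give the line its working
forms: the budget form on
the KNOWN manifold (CorkSymmetrisation, filed informal: a τ-symmetric 1-jet along the cork boundary
inside an almost-round
Ric ≥ 3 metric on S⁴ transports Ric and Vol through the cork twist) and the fill-in recogniser
(NearExtremalFillIn, filed
informal: near-extremal Ric ≥ 3 fill-ins of a sub-equatorial round S³ are standard balls).
Lean: `∀ (M : Type) [TopologicalSpace M] [T2Space M] [SecondCountableTopology M] [ChartedSpace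
(EuclideanSpace ℝ (Fin 4)) M] [IsManifold (𝓡 4) ∞ M] [CompactSpace M] [MeasurableSpace M]
[BorelSpace M], M ≃ₕ Metric.sphere (0 : EuclideanSpace ℝ (Fin 5)) 1 → ∀ δ : ℝ, 0 < δ → ∃ h :
Bundle.ContMDiffRiemannianMetric (𝓡 4) ∞ (EuclideanSpace ℝ (Fin 4)) (TangentSpace (𝓡 4) : M → Type
_), ∃ _ : (Literature.Geometry.Lorentzian.PseudoRiemannianMetric.ofRiemannian h).HasLeviCivita, (∀
(x : M) (v : TangentSpace (𝓡 4) x), 3 * h.inner x v v ≤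
(Literature.Geometry.Lorentzian.PseudoRiemannianMetric.ofRiemannian h).ricci x v v) ∧ ENNReal.ofReal
((1 - δ) * (8 * Real.pi ^ 2 / 3)) ≤ Literature.Geometry.Lorentzian.riemannianMeasure h Set.univ`

## Assembly
Pure logic plus packaging: given the recognition fact (∃ δ) and X, fix M ≃ₕ S⁴ from the summit
binder; M is compact
(`Literature.Topology.FourManifolds.compactSpace_of_homotopyEquiv_sphere_four_holds`, proved in
tree) and path connected
(`pathConnectedSpace_of_homotopyEquiv` + `pathConnectedSpace_sphere_four`, same file), `borel M`
supplies the measurable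
structure, T3 follows from compact + T2; X at this δ gives h with Ric ≥ 3h and Vol ≥ (1−δ)·8π²/3
(and its Levi-Civita
instance), the fact returns `Nonempty (M ≃ₘ S⁴)`, which is `SmoothPoincare4` unfolded. Provable now
(≈ 25 lines).

Rationale: WHY THIS LINE. Bishop's inequality gives Vol ≤ 8π²/3 for any closed 4-manifold with Ric ≥ 3, with
equality only for the round S⁴; Colding's
volume-convergence and the Cheeger–Colding Reifenberg method (Colding1997; CheegerColding1997 Thms
A.1.8–A.1.12, p. 459 read)
upgrade "within δ(4)·8π²/3 of the bound" to a DIFFEOMORPHISM with S⁴ (Perelman1994 had the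
homeomorphism), so the smooth
invariant V(M) has a PROVEN gap separating every exotic 4-sphere from S⁴ and lies outside all
catalogued blindness classes
(it is defined through the smooth structure's own metrics). What is imported: comparison geometry /
synthetic Ricci bounds
(CheegerColding1996, CheegerColding1997, KapovitchKettererSturm2023), Ric > 0 gluing and fill-in
geometry (Perelman1997BigVolume,
Burdick2019, HangWang2009, HeintzeKarcher1978, Kasue1983, MiaoWang2016, Perales2016) and the cork
theorem
(CurtisFreedmanHsiangStong1996, Matveyev1996); a Ricci LOWER bound plus one global number replaces
the pointwise cones of
route PIC (PIC/PSC/LCF recognised by Ricci flow or Kuiper) and survives codimension-1 isometric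
regluing exactly, which
pointwise conditions do not. No probabilistic/spectral reformulation is used; the negatives index is
empty (2026-08-15).

RANKED CRUXES. #2 VolumeSphereRecognition (crux) — Cheeger–Colding's differentiable volume-sphere
theorem in dimension 4 (CheegerColding1997 Thm A.1.10 with n = 4, the NAMED FACT this line rests on;
filed first per the cone rule, to be vendored as a Literature fact and then threaded as a
hypothesis): there is δ > 0 such that every compact connected smooth 4-manifold with a C^∞
Riemannian metric h satisfying Ric_h ≥ 3h and Vol(M, h) ≥ (1 − δ)·8π²/3 is diffeomorphic to S⁴.
[difficulty: XL] (why it might fail: Only by mis-transcription: connectedness is essential (two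
round S⁴'s have volume 16π²/3), Vol must be the Euclidean-normalised `riemannianMeasure` (unit round
S⁴ = 8π²/3), δ depends on n only; formalising CC (volume convergence + Reifenberg + A.1.12) is XL,
so it enters as a cited fact.) [CheegerColding1997, Colding1997, Perelman1994, CheegerColding1996]
#3 RicciFatSphere (crux) — the thesis X (card item 1, "V(Σ) = V₄"): for every closed smooth M ≃ₕ S⁴
and every δ > 0 there is a C^∞ Riemannian metric h on M with Ric_h ≥ 3h and Vol(M, h) ≥ (1 −
δ)·8π²/3. [deps: VolumeSphereRecognition] [difficulty: open-problem] (why it might fail: False iff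
some homotopy 4-sphere is exotic (then V(Σ) ≤ (1−δ₄)·8π²/3 by A.1.10); constructively, Ric ≥ 3 with
almost-round volume forces GH-closeness to S⁴ at every scale (Bishop–Gromov), so only an
almost-isometry can witness it — handles: CorkSymmetrisation, the fill-in form.)
[CheegerColding1997, Colding1997, Perelman1997BigVolume, Burdick2019]
#9 Spc4ImpliesRicciFatSphere (support) — consistency / normalisation check: SmoothPoincare4 →
RicciFatSphere (pull the round metric back along the diffeomorphism: Ric = 3g, Vol = 8π²/3 under
`riemannianMeasure`; uses the tree's `roundMetric`, the named fact `ricci_roundMetric` and the chart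
formula `riemannianMeasure_eq_integral_sqrt_det_holds`). [difficulty: L] [CheegerColding1997,
Literature.Geometry.Riemannian.ricci_roundMetric,
Literature.Geometry.Lorentzian.riemannianMeasure_eq_integral_sqrt_det]

TWO-LAYER PLAN. Foreseen glued splits (nothing filed now). (a) RicciFatSphere ⇐ CorkSymmetrisation →
CorkTwistCovers → RicciFatSphere, where
CorkTwistCovers = "every M ≃ₕ S⁴ is a cork twist (S⁴ ∖ C̊) ∪_τ C" (cork theorem
`Literature.Topology.FourManifolds.Matveyev1996_decomposition`
applied to the h-cobordism Σ ∼ S⁴, KervaireMilnor1963) and the glue is the C^{1,1}-regluing +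
mollification rider (Ric ≥ 3(1−η), volume
loss → 0; KapovitchKettererSturm2023 for the synthetic form). (b) The fill-in assembly RicciFatBall
→ NearExtremalFillIn →
(`Literature.Topology.FourManifolds.cerf_twistedSphere_four`) → SmoothPoincare4, with RicciFatBall =
"every compact contractible
smooth Δ with ∂Δ ≅ S³ admits, for each ε > 0, an admissible fill-in metric (Ric ≥ 3, ∂Δ ≅ S³(sin ρ₀)
round, II ≥ −cot ρ₀) of volume
≥ V(ρ₀) − ε", filed once NearExtremalFillIn is typed (definition request D1). (c)
VolumeSphereRecognition is never split: it is
vendored as a Literature fact and the assembly restated with `(h : fact) →`.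

KILL CRITERIA. An exotic homotopy 4-sphere proved anywhere refutes RicciFatSphere (and
CorkSymmetrisation, RicciFatBall) at once — close
`refuted:RicciFatSphere`. A theorem "Ric > 0 (any volume) on a homotopy 4-sphere/ball with the
stated boundary data ⇒ standard"
moots the volume threshold and collapses the line into route PIC's existence statement — close
`superseded --by route-SmoothPoincare4-PIC`
after filing the Ric ≥ 3 existence crux there. CorkSymmetrisation shown false for a cork whose twist
is KNOWN standard (e.g. the
Akbulut–Mazur cork in its doubled position) kills the budget form only — drop it and keep X +
fill-in. If the quantitative gluing
rider fails (collar cannot keep Ric ≥ 3 − η with vanishing volume loss) NearExtremalFillIn is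
restated over Perales-type boundary
volume convergence or dropped; X is unaffected.

NOT DECOMPOSED YET. The constant δ(4) (ineffective in CheegerColding1997; no explicit value is
claimed anywhere); the C^{1,1} mollification rider
and the quantitative Perelman collar (support lemmas provers attach with `--supports`); the
critical-element picture (volume-maximising
sequences on a putative exotic Σ subconverge to a non-collapsed RCD(3,4) space that is Einstein
where smooth — a rigidity
conjecture "volume-maximal RCD(3,4) limits of homotopy 4-spheres are round" for the synthetic
community); the explicit-threshold
sectional variant (sec ≥ 1 ∧ diam > π/2 ⇒ twisted sphere ⇒ S⁴ by `cerf_twistedSphere_four`, cf.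
ProSillWilhelm2017 §5 for the same
Cerf move) — all layer-2 or other routes.

CHEAPEST FALSIFIER. Lookup + one computation. (i) DONE this session: CheegerColding1997 p. 459
states Thm A.1.10 with "diffeomorphic" for all n;
`riemannianMeasure` is Euclidean-normalised (Volume.lean docstring: unit round S² has area 4π), so
8π²/3 is the right constant.
(ii) DONE: the card's hemisphere endpoint (boundary UNIT round S³, II ≥ 0) is Hang–Wang-rigid
(HangWang2009 Thm 2, p. 3: any such
Ric ≥ 3 filling IS the hemisphere), so the fill-in crux is stated for sub-equatorial boundaries
S³(sin ρ₀), ρ₀ < π/2, where big caps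
of smaller spheres show the admissible class is non-rigid below the maximum. (iii) TO RUN (kit): for
the Akbulut–Mazur cork
(C, τ) ⊂ S⁴ in doubled position, minimise the volume defect over τ-symmetrised rotationally-assisted
metric ansätze with Ric ≥ 3 —
a definite positive defect for a cork with standard twist kills CorkSymmetrisation as a road to
SPC4.

NUMBERS. V₄ = Vol(S⁴) = 8π²/3 ≈ 26.32 (Bishop bound under Ric ≥ 3, equality iff round). Fill-in
models: V(ρ₀) = Vol_{S⁴}(B_{π−ρ₀}) =
2π²(2/3 + cos ρ₀ − cos³ρ₀/3), e.g. V(π/3) = 9π²/4 ≈ 22.21, V(π/2) = 4π²/3 (hemisphere, rigid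
endpoint). δ(4) of A.1.10 and
Perelman1994's δ₄: no effective value in print. Boundary data convention (HangWang2009 p. 3): ν
outer unit normal, II(X,Y) =
⟨∇_X ν, Y⟩; geodesic ball B_ρ ⊂ S⁴ has II = cot ρ · g, so the big cap B_{π−ρ₀} has II = −cot ρ₀ · g,
H = −3 cot ρ₀. Items at
open: 4 typed (2 cruxes, 1 support, assembly) + 2 informal cruxes filed right after open = 6.

DEFINITION REQUESTS. D1 (for NearExtremalFillIn / RicciFatBall): `IsAdmissibleFillIn r c g b` over
`b : Literature.Topology.FourManifolds.BoundaryData (𝓡∂ 4) Δ (𝓡 3)`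
and a C^∞ Riemannian metric g on TΔ — (∂Δ, induced metric along b.incl) is isometric to the round S³
of radius r and the second
fundamental form of b.incl w.r.t. the outward unit normal is ≥ c · (induced metric); built from
`Literature.Geometry.Lorentzian.Hypersurface`
(inducedMetric, secondFundamentalForm, IsUnitNormal); topic Literature/Geometry/Riemannian. Cite
facts wanted (family spc4):
F1 CheegerColding1997 Thm A.1.10 (n = 4 instance = VolumeSphereRecognition verbatim); F2
HeintzeKarcher1978 §3 volume
comparison for Ric ≥ (n−1), H ≥ (n−1)λ with Kasue1983 Thm A(2) rigidity (fill-in volume ≤ V(ρ₀),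
equality iff the cap);
F3 Perelman1997BigVolume §4 gluing lemma in the form of Burdick2019 Lemma 1.2 WITH the quantitative
rider flagged open-to-pin
(collar keeps Ric ≥ κ − η, volume loss → 0); F4 HangWang2009 Thms 2–3 (rigid endpoint, for the
record).

Novelty: Searches (2026-08-15): `lit frontier SmoothPoincare4 --since 2020` (30 rows: trisections, corks,
knot traces, exotic ℝ⁴ — none
Riemannian-comparison); `lit bridges SmoothPoincare4 --cross any` (30 rows, noise); `lit search
--source zbmath "positive Ricci
curvature almost maximal volume"` (14: Perelman1994, CheegerColding1996, entropy-rigidity papers;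
nothing on homotopy 4-spheres);
`… "Ricci curvature lower bound volume close to sphere diffeomorphic Cheeger Colding"` (1); `…
"Kasue Ricci curvature geodesics …
boundary"` (1: Kasue1983, Thm A read); `… "Miao Wang boundary effect of Ricci curvature"` (2:
MiaoWang2016 read — total mean
curvature, not volume); `lit search --source crossref "Reiser Wraith gluing Ricci curvature"` (12:
KapovitchKettererSturm2023
weak gluing found); `lit galaxy search "almost maximal volume" --star pdf` (3: ProSillWilhelm2017
found and read, §5 uses Cerf in
dim 4; `--star all` queue-saturated twice); `lit read` of CheegerColding1997 (grep A.1.10, p. 459),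
HangWang2009 (Thms 2–3, p. 3),
ProSillWilhelm2017 (pp. 3–4, 16–17); `ledger negatives` (0); `ledger idea list` (129 cards;
Riemannian ones: PIC-type,
weyl-budget, yamabe, perelman-entropy, definite-connection — none uses Ric lower bound + volume).
Nearest prior art found: CheegerColding1997 Thm A.1.10 (the recogniser itself; "exotic Σ⁴ is
Ricci-thin" is its unprinted
corollary); Perelman1994 (homeomorphic version); ProSillWilhelm2017 (doi:10.4310/cag.2017.v25.n1.a8:
almost-maximal volume ⇒
diffeomor  [refs: 10.4310/cag.2017.v25.n1.a8:, doi:10.4310/cag.2017.v25.n1.a8, Perelman1994, CheegerColding1996, Kasue1983, MiaoWang2016, KapovitchKettererSturm2023, ProSillWilhelm2017, CheegerColding1997, HangWang2009, HeintzeKarcher1978, CurtisFreedmanHsiangStong1996, Matveyev1996]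

Barriers (technique_class: ricci-volume-recognition, cork-symmetrisation): - technique_class: ricci-volume-recognition, cork-symmetrisation
- Literature.Barriers.SmoothPoincare4.TopologicalBarrierFour: evaded — V(M) = sup{Vol : Ric ≥ 3} is
an invariant of the SMOOTH structure (defined through its own metrics) and A.1.10 proves it
separates any exotic Σ from S⁴, so it is not a homeomorphism invariant; honest flip side: V is not
computable on a given candidate, so no refutation engine is claimed.
- Literature.Barriers.SmoothPoincare4.StableBarrierFour: evaded — V is not S²×S²-stable (V(Σ #
k(S²×S²))-type quantities are not even comparable to V(Σ)); nothing is inferred from a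
stabilisation.
- Literature.Barriers.SmoothPoincare4.HCobordismInvariantBarrierFour: evaded — V is not constant on
h-cobordism classes (it distinguishes Σ from S⁴ whenever they differ) and no h-cobordism ⇒
diffeomorphism step occurs; the diffeomorphism comes from Cheeger–Colding Reifenberg charts.
- Literature.Barriers.SmoothPoincare4.HCobordismBarrierFour: not engaged — the h-cobordism Σ ∼ S⁴
enters only through the cork theorem (to parametrise candidates as cork twists of S⁴), never through
an h-cobordism ⇒ product claim.
- Literature.Barriers.SmoothPoincare4.GaugeSumBarrierFour: not engaged — no gauge-theoretic or
sum-stable invariant is evaluated.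
- Literature.Barriers.SmoothPoincare4.TwistedSphereBarrierFour: used positively only (fill-in
assembly ends with `cerf_twistedSphere_four`; nothing exotic is built from Diff(S³)).
- Literature.Barriers.SmoothPoincare4.ContractibleBar

History (route lifecycle, newest last):
- 2026-08-23T10:36:41Z · DORMANT — reconciler: no traction for 6.1 d (last activity statement-checked at 2026-08-17T08:20:21Z); parked, not closed — `ledger route dormant route-SmoothPoincare4-Ri (operator:999:1431578)

sub-problem: SmoothPoincare4 · status: dormant · opened planner-plancard-SmoothPoincare4-SmoothPoinca-f751b257-0 2026-08-15T11:40:19Z · rev 4 · ledger route-SmoothPoincare4-RicciFat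
GENERATED by the gate from the ledger (D-0016/17). Provers cite these decls: `theorem foo : Summit.SmoothPoincare4.SmoothPoincare4.Theses.RicciFat.<Decl> := …` in Summits/SmoothPoincare4/SmoothPoincare4/Theorems/<Name>.lean.
-/

namespace Summit.SmoothPoincare4.SmoothPoincare4.Theses.RicciFat

open scoped BigOperators Topology Manifold Classical MeasureTheory ProbabilityTheory Matrix InnerProductSpace ComplexConjugate ContinuousMap ContDiff
open Filter Set Function TopologicalSpace MeasureTheory

attribute [summit_statement] _root_.SmoothPoincare4

open Literature.SPC4

/-- item stmt-SmoothPoincare4-18079 · crux · rank 2 · open · by planner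
why it might fail: Known in print (CC97 Thm A.1.12 at S⁴): can fail only by rendering — d_h.toReal needs ConnectedSpace (present); ε-approximation vs d_GH differ by factors 3/2, 2 (proved GHDecompositionProofs §4/§6), absorbed by ∃ε. Real risk = size: Reifenberg A.1.2–3 + volume convergence A.1.5, no Lean precedent.
sources: CheegerColding1997, App. 1 Thm A.1.12 (p. 459); Thms A.1.1–A.1.3 (p. 457), A.1.5, A.1.8–A.1.9 (pp. 458–459); lit paper:doi-10-4310-jdg-1214459974 pp. 52–54 read, Colding1997, CheegerColding1996, Colding1997Aspects, Def. 2.1, Literature.Geometry.Riemannian.CheegerColding1997_sphereStability, Summits/SmoothPoincare4/SmoothPoincare4/Cruxes/VolumeSphereRecognition/Lines/birth.lean (stub_sphereStabilityFour, sphereStabilityFour_of_fact)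
[crux] SPHERE STABILITY IN DIMENSION FOUR — PROMOTED LITERATURE FACT (route-choice planner
2026-08-17, unit rchoice-Summits-SmoothPoincare4-Smooth-b5df2e98; payload.route_choice: the
Literature fact Literature.Geometry.Riemannian.CheegerColding1997_sphereStability is XL-apex — too
large for one prover seat, non-crux facts are not split ⇒ promote-to-crux). STATEMENT = the
registered stub stub_sphereStabilityFour of line `birth` of crux #2 VolumeSphereRecognition
(Cruxes/VolumeSphereRecognition/Lines/birth.lean) VERBATIM = the n = 4 instance of the fact (bridge
sphereStabilityFour_of_fact proved there; re-checked in the planner's Sketch.lean, lean rc 0): there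
is ε > 0 such that every compact connected C^∞ Riemannian 4-manifold (M, h) (T2, second countable,
charts on ℝ⁴, the tree's Levi-Civita instance) with Ric_h ≥ −3h that admits an ε-Gromov–Hausdorff
approximation f : M → S⁴ to the unit ROUND sphere (IsRoundSphereGHApprox 4 h ε f: distortion ≤ ε of
the great-circle distance arccos⟪f a, f b⟫ against the length distance d_h =
Manifold.riemannianEDist, ε-dense image) is C^∞-diffeomorphic to S⁴ ⊂ ℝ⁵ — Cheeger–Colding, J.
Differential Geom. 46 (1997), Appendix 1, Thm A.1.12 (p. 459, re -/
@[route_item "route-SmoothPoincare4-RicciFat"]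
def SphereStabilityFour : Prop :=
  ∃ ε : ℝ, 0 < ε ∧ ∀ (M : Type) [TopologicalSpace M] [T2Space M] [SecondCountableTopology M] [ChartedSpace (EuclideanSpace ℝ (Fin 4)) M] [IsManifold (𝓡 4) ∞ M] [CompactSpace M] [ConnectedSpace M] [MeasurableSpace M] [BorelSpace M] (h : Bundle.ContMDiffRiemannianMetric (𝓡 4) ∞ (EuclideanSpace ℝ (Fin 4)) (TangentSpace (𝓡 4) : M → Type _)) [(Literature.Geometry.Lorentzian.PseudoRiemannianMetric.ofRiemannian h).HasLeviCivita], (∀ (x : M) (v : TangentSpace (𝓡 4) x), -3 * h.inner x v v ≤ (Literature.Geometry.Lorentzian.PseudoRiemannianMetric.ofRiemannian h).ricci x v v) → (∃ f : M → Metric.sphere (0 : EuclideanSpace ℝ (Fin 5)) 1, Literature.Geometry.Riemannian.IsRoundSphereGHApprox 4 h ε f) → Nonempty (M ≃ₘ⟮𝓡 4, 𝓡 4⟯ Metric.sphere (0 : EuclideanSpace ℝ (Fin 5)) 1)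

/-- item stmt-SmoothPoincare4-5191 · crux · rank 2 · open · by planner
why it might fail: Only by mis-transcription: connectedness is essential (two round S⁴'s have volume 16π²/3), Vol must be the Euclidean-normalised `riemannianMeasure` (unit round S⁴ = 8π²/3), δ depends on n only; formalising CC (volume convergence + Reifenberg + A.1.12) is XL, so it enters as a cited fact.
sources: CheegerColding1997, Colding1997, Perelman1994, CheegerColding1996
[crux] Cheeger–Colding's differentiable volume-sphere theorem in dimension 4 (CheegerColding1997 Thm
A.1.10 with n = 4, the NAMED FACT this line rests on; filed first per the cone rule, to be vendored
as a Literature fact and then threaded as a hypothesis): there is δ > 0 such that every compact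
connected smooth 4-manifold with a C^∞ Riemannian metric h satisfying Ric_h ≥ 3h and Vol(M, h) ≥ (1
− δ)·8π²/3 is diffeomorphic to S⁴. [difficulty: XL] -/
@[route_item "route-SmoothPoincare4-RicciFat", crux]
def VolumeSphereRecognition : Prop :=
  ∃ δ : ℝ, 0 < δ ∧ ∀ (M : Type) [TopologicalSpace M] [T2Space M] [SecondCountableTopology M] [ChartedSpace (EuclideanSpace ℝ (Fin 4)) M] [IsManifold (𝓡 4) ∞ M] [CompactSpace M] [ConnectedSpace M] [MeasurableSpace M] [BorelSpace M] (h : Bundle.ContMDiffRiemannianMetric (𝓡 4) ∞ (EuclideanSpace ℝ (Fin 4)) (TangentSpace (𝓡 4) : M → Type _)) [(Literature.Geometry.Lorentzian.PseudoRiemannianMetric.ofRiemannian h).HasLeviCivita], (∀ (x : M) (v : TangentSpace (𝓡 4) x), 3 * h.inner x v v ≤ (Literature.Geometry.Lorentzian.PseudoRiemannianMetric.ofRiemannian h).ricci x v v) → ENNReal.ofReal ((1 - δ) * (8 * Real.pi ^ 2 / 3)) ≤ Literature.Geometry.Lorentzian.riemannianMeasure h Set.univ → Nonempty (M ≃ₘ⟮𝓡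 4, 𝓡 4⟯ Metric.sphere (0 : EuclideanSpace ℝ (Fin 5)) 1)

/-- item stmt-SmoothPoincare4-5192 · crux · rank 3 · open · by planner
why it might fail: False iff some homotopy 4-sphere is exotic (then V(Σ) ≤ (1−δ₄)·8π²/3 by A.1.10); constructively, Ric ≥ 3 with almost-round volume forces GH-closeness to S⁴ at every scale (Bishop–Gromov), so only an almost-isometry can witness it — handles: CorkSymmetrisation, the fill-in form.
sources: CheegerColding1997, Colding1997, Perelman1997BigVolume, Burdick2019
[crux] the thesis X (card item 1, "V(Σ) = V₄"): for every closed smooth M ≃ₕ S⁴ and every δ > 0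
there is a C^∞ Riemannian metric h on M with Ric_h ≥ 3h and Vol(M, h) ≥ (1 − δ)·8π²/3. [deps:
VolumeSphereRecognition] [difficulty: open-problem] -/
@[route_item "route-SmoothPoincare4-RicciFat", crux]
def RicciFatSphere : Prop :=
  ∀ (M : Type) [TopologicalSpace M] [T2Space M] [SecondCountableTopology M] [ChartedSpace (EuclideanSpace ℝ (Fin 4)) M] [IsManifold (𝓡 4) ∞ M] [CompactSpace M] [MeasurableSpace M] [BorelSpace M], M ≃ₕ Metric.sphere (0 : EuclideanSpace ℝ (Fin 5)) 1 → ∀ δ : ℝ, 0 < δ → ∃ h : Bundle.ContMDiffRiemannianMetric (𝓡 4) ∞ (EuclideanSpace ℝ (Fin 4)) (TangentSpace (𝓡 4) : M → Type _), ∃ _ : (Literature.Geometry.Lorentzian.PseudoRiemannianMetric.ofRiemannian h).HasLeviCivita, (∀ (x : M) (v : TangentSpace (𝓡 4) x), 3 * h.inner x v v ≤ (Literature.Geometry.Lorentzian.PseudoRiemannianMetric.ofRiemannian h).ricci x v v) ∧ ENNReal.ofReal ((1 - δ) * (8 * Real.pi ^ 2 / 3)) ≤ Literature.Geometry.Lorentzian.riemannianMeasure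 h Set.univ

/-- item stmt-SmoothPoincare4-18048 · crux · rank 4 · open · by planner
why it might fail: False iff some homotopy 4-sphere is Ricci-thin below Vol(S⁴)/3 — e.g. iff an exotic Σ⁴ admits no Ric > 0 metric at all (codim-2 surgeries from S⁴: no Ric > 0 surgery theorem); Hang–Wang Thm 3 forbids witnesses that are round outside a sub-hemispherical domain, so no local surgery on g_round works.
sources: Perelman1997BigVolume, Burdick2019, HangWang2009, arXiv:0911.0380, CheegerColding1997, ShaYang1991
[crux] FAT BEYOND THE WEYL GAP — piece 2/2 of the Weyl-gap threshold split of RicciFatSphere (BC2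
redirect, crux-strategist 2026-08-17): every closed smooth homotopy 4-sphere M carries a C^∞
Riemannian metric h (with its Levi-Civita connection) with Ric_h ≥ 3h and Vol(M, h) > 8π²/9 =
Vol(S⁴)/3 — 'exotic 4-spheres, if any, are at least a third as fat as S⁴'. The EXISTENCE half:
strictly weaker than RicciFatSphere (which asks Vol ≥ (1−δ)·8π²/3 for every δ) and not known to
imply SPC4 (it does so only together with RecognitionBeyondWeylGap, since δ(4) of Cheeger–Colding is
ineffective); strictly stronger than route InstantonEntropy's ExistRicPos (Ric > 0, any volume).
Implied by SPC4 (round metric transported, 8π²/3 > 8π²/9). Plan (registered skeleton): ball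
splitting M = 𝔻⁴ ∪_φ Δ (Δ compact contractible, ∂Δ ≅ S³; Milnor disc + van Kampen/Mayer–Vietoris,
KNOWN) + an admissible big-cap fill-in of Δ (Ric ≥ 3, boundary round S³(sin ρ₀), II ≥ −cot ρ₀, ρ₀ <
π/2 — the non-rigid side of Hang–Wang) whose volume exceeds 8π²/9 − Vol(B_ρ₀) with slack (OPEN stub,
the budget form of stub_ricciFatBall of line birth: a volume DEFICIT of up to 2/3 of the round
volume is allowed) + Perelman cap gluing -/
@[route_item "route-SmoothPoincare4-RicciFat", crux]
def FatBeyondWeylGap : Prop :=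
  ∀ (M : Type) [TopologicalSpace M] [T2Space M] [SecondCountableTopology M] [ChartedSpace (EuclideanSpace ℝ (Fin 4)) M] [IsManifold (𝓡 4) ∞ M] [CompactSpace M] [MeasurableSpace M] [BorelSpace M], M ≃ₕ Metric.sphere (0 : EuclideanSpace ℝ (Fin 5)) 1 → ∃ h : Bundle.ContMDiffRiemannianMetric (𝓡 4) ∞ (EuclideanSpace ℝ (Fin 4)) (TangentSpace (𝓡 4) : M → Type _), ∃ _ : (Literature.Geometry.Lorentzian.PseudoRiemannianMetric.ofRiemannian h).HasLeviCivita, (∀ (x : M) (v : TangentSpace (𝓡 4) x), 3 * h.inner x v v ≤ (Literature.Geometry.Lorentzian.PseudoRiemannianMetric.ofRiemannian h).ricci x v v) ∧ ENNReal.ofReal (8 * Real.pi ^ 2 / 9) < Literature.Geometry.Lorentzian.riemannianMeasure h Set.univ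

/-- item stmt-SmoothPoincare4-18049 · crux · rank 5 · open · by planner
why it might fail: Asserts δ₄ ≥ 2/3 on homotopy spheres while CC97's δ(4) is ineffective: an exotic Σ⁴ with Ric ≥ 3 and Vol > 8π²/9 refutes it; and the Einstein-reduction plan can die first — volume-maximising sequences may converge to a SINGULAR RCD(3,4) space, not a smooth Einstein metric.
sources: arXiv:math/9807055, doi:10.1023/a:1006597912184, CheegerColding1997, Colding1997, Perelman1994, Hitchin1974
[crux] RECOGNITION BEYOND THE WEYL GAP — piece 1/2 of the Weyl-gap threshold split of RicciFatSphere
(BC2 redirect, crux-strategist 2026-08-17): a closed smooth homotopy 4-sphere M carrying a C^∞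
Riemannian metric with Ric ≥ 3 and Vol(M) > 8π²/9 = Vol(S⁴)/3 is diffeomorphic to S⁴ — i.e.
Cheeger–Colding's ineffective δ(4) of VolumeSphereRecognition can be taken = 2/3 ON HOMOTOPY
4-SPHERES. The threshold is the Gursky–LeBrun Weyl gap: a compact oriented Einstein 4-manifold with
s > 0 and W⁺ ≢ 0 (resp. W⁻ ≢ 0) has ∫|W^±|² ≥ ∫s²/24 (GurskyLeBrun1999 Thm 1 / Cor 1,
arXiv:math/9807055 p. 8 read), so by Chern–Gauss–Bonnet/Hirzebruch ((2χ∓3τ) =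
(1/4π²)∫[2|W^∓|²+s²/24] for Einstein) an Einstein metric Ric = 3g on a homotopy 4-sphere (χ=2, τ=0)
with Vol > 8π²/9 has W ≡ 0, hence constant curvature 1, hence is the round S⁴ (Killing–Hopf): the
KNOWN half of this piece's skeleton. The OPEN half (registered stub_einsteinReduction): a homotopy
4-sphere that is fat beyond the gap carries an EINSTEIN metric Ric = 3g that is fat beyond the gap —
volume maximisation under Ric ≥ 3 (direct method: RCD(3,4) compactness + Colding volume continuity;
regularity of volume-maximal limits: Bishop–Gromov gives -/
@[route_item "route-SmoothPoincare4-RicciFat", crux]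
def RecognitionBeyondWeylGap : Prop :=
  ∀ (M : Type) [TopologicalSpace M] [T2Space M] [SecondCountableTopology M] [ChartedSpace (EuclideanSpace ℝ (Fin 4)) M] [IsManifold (𝓡 4) ∞ M] [CompactSpace M] [MeasurableSpace M] [BorelSpace M], M ≃ₕ Metric.sphere (0 : EuclideanSpace ℝ (Fin 5)) 1 → (∃ h : Bundle.ContMDiffRiemannianMetric (𝓡 4) ∞ (EuclideanSpace ℝ (Fin 4)) (TangentSpace (𝓡 4) : M → Type _), ∃ _ : (Literature.Geometry.Lorentzian.PseudoRiemannianMetric.ofRiemannian h).HasLeviCivita, (∀ (x : M) (v : TangentSpace (𝓡 4) x), 3 * h.inner x v v ≤ (Literature.Geometry.Lorentzian.PseudoRiemannianMetric.ofRiemannian h).ricci x v v) ∧ ENNReal.ofReal (8 * Real.pi ^ 2 / 9) < Literature.Geometry.Lorentzian.riemannianMeasure h Set.univ) → Nonempty (M ≃ₘ⟮𝓡 4, 𝓡 4⟯ Metric.sphere (0 : EuclideanSpace ℝ (Fin 5)) 1)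

-- item stmt-SmoothPoincare4-6299 · support · rank 4 · open · by planner — informal only, no Lean statement yet:
--   [crux] CORK SYMMETRISATION (card ricci-fat-homotopy-balls item 3; the budget form on the KNOWN
--   manifold). For a cork (C, τ) smoothly embedded in the standard S⁴ — C ⊂ S⁴ compact contractible
--   smooth codimension-0, Y = ∂C, τ : Y → Y an involutive diffeomorphism (tree:
--   Literature.Topology.FourManifolds.IsCork over BoundaryData) — and every ε > 0 there is a C^∞
--   Riemannian metric g on S⁴ with (i) Ric_g ≥ 3g, (ii) Vol(S⁴, g) ≥ (1 − ε)·8π²/3, (iii) τ an isometry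
--   of the induced metric g|_Y, (iv) τ^*II = II, II the second fundamental form of Y ⊂ (S⁴, g) w.r.t.
--   the unit normal pointing out of C (HangWan

/-- item stmt-SmoothPoincare4-6330 · support · rank 5 · open · by planner
[crux] NEAR-EXTREMAL FILL-INS ARE STANDARD BALLS (card item 2, corrected). Fix ρ₀ ∈ (0, π/2). An
ADMISSIBLE FILL-IN is a compact connected smooth Riemannian 4-manifold with boundary (Δ, g) with
Ric_g ≥ 3g, (∂Δ, g|∂Δ) isometric to the round 3-sphere of radius sin ρ₀, and II_{∂Δ} ≥ −cot ρ₀ ·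
g|∂Δ (outer unit normal ν, II(X,Y) = ⟨∇_X ν, Y⟩, HangWang2009 p. 3; the model is the big cap
B_{π−ρ₀} ⊂ S⁴, whose boundary has II = −cot ρ₀ · g exactly). STATEMENT: there is ε = ε(ρ₀) > 0 such
that every admissible fill-in with Vol(Δ, g) ≥ V(ρ₀) − ε, where V(ρ₀) := Vol_{S⁴}(B_{π−ρ₀}) =
2π²(2/3 + cos ρ₀ − cos³ρ₀/3), is diffeomorphic to the closed 4-ball (model 𝓡∂ 4). COMPANION (known,
support-level): every admissible fill-in has Vol ≤ V(ρ₀), equality iff isometric to the cap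
(HeintzeKarcher1978 §3 volume comparison from H ≥ −3cot ρ₀ and Ric ≥ 3; Kasue1983 Thm A for the
rigidity pattern); hence RicciFatBall := 'sup of Vol over admissible fill-ins of Δ equals V(ρ₀) for
every compact contractible smooth Δ with ∂Δ ≅ S³' is ⇔ SmoothPoincare4 given this crux +
Literature.Topology.FourManifolds.cerf_twistedSphere_four (Two-layer plan (b)). CORRECTION OF THE
CARD: the endpoint ρ₀ = π/2 (boundary UNIT S³, -/
@[route_item "route-SmoothPoincare4-RicciFat"]
def NearExtremalFillIn : Prop :=
  ∀ ρ₀ : ℝ, 0 < ρ₀ → ρ₀ < Real.pi / 2 → ∃ ε : ℝ, 0 < ε ∧ ∀ (Δ : Type) [TopologicalSpace Δ] [T2Space Δ] [SecondCountableTopology Δ] [ChartedSpace (EuclideanHalfSpace 4) Δ] [IsManifold (𝓡∂ 4) ∞ Δ] [CompactSpace Δ] [ConnectedSpace Δ] [MeasurableSpace Δ] [BorelSpace Δ] (b : Literature.Topology.FourManifolds.BoundaryData (𝓡∂ 4) Δ (𝓡 3)) (h : Bundle.ContMDiffRiemannianMetric (𝓡∂ 4) ∞ (EuclideanSpace ℝ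 (Fin 4)) (TangentSpace (𝓡∂ 4) : Δ → Type _)) [(Literature.Geometry.Lorentzian.PseudoRiemannianMetric.ofRiemannian h).HasLeviCivita], Literature.Geometry.Riemannian.HasRicciLowerBound (Literature.Geometry.Lorentzian.PseudoRiemannianMetric.ofRiemannian h) 3 → Literature.Geometry.Riemannian.IsAdmissibleFillIn (Literature.Geometry.Lorentzian.PseudoRiemannianMetric.ofRiemannian h) b (Real.sin ρ₀) (-Real.cot ρ₀) → ENNReal.ofReal (2 * Real.pi ^ 2 * (2 / 3 + Real.cos ρ₀ - Real.cos ρ₀ ^ 3 / 3) - ε) ≤ Literature.Geometry.Lorentzian.riemannianMeasure h Set.univ → (letI := Literature.Topology.FourManifolds.instChartedSpaceClosedBall (n := 3); Nonempty (Δ ≃ₘ⟮𝓡∂ 4, 𝓡∂ 4⟯ (Metric.closedBall (0 : EuclideanSpace ℝ (Fin 4)) 1)))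

/-- item stmt-SmoothPoincare4-18050 · support · rank 9 · open · by planner
sources: arXiv:math/9807055, CheegerColding1997, ONeill1983
[support] [glue] The Weyl-gap threshold split of RicciFatSphere ASSEMBLES (BC2 redirect of the
RESTATED deciding crux, crux-strategist 2026-08-17; the `route edit --split` verb is
final-cycle-gated for this seat, so the two pieces are filed as top-level cruxes and this glue
carries the assembly; on a final cycle: `route edit --split RicciFatSphere --into children.json
--glue-by Summit.SmoothPoincare4.SmoothPoincare4.Theorems.ricciFatSphere_of_weylGap`). PROVABLE NOW
— PROVED sorry-free: theorem ricciFatSphere_of_weylGap in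
Cruxes/RicciFatSphere/Lines/WeylGapSplit.lean (commit d154e9f8fd4f; lean check rc 0, 0 sorries,
axioms propext/Classical.choice/Quot.sound; hypotheses = these two decls spelled out verbatim),
landable VERBATIM as Theorems/RicciFatRicciFatSphereSplit.lean (Theorems/ is prover-only for the
strategist seat), after which this item closes by `theorem ricciFatSphereOfWeylGap_proof :
RicciFatSphereOfWeylGap := fun hR hF => ricciFatSphere_of_weylGap hR hF`. Proof (25 lines, real
transport, not `exact ⟨h₁,h₂⟩`): fix M ≃ₕ S⁴ and δ > 0; FatBeyondWeylGap gives a C^∞ metric with Ric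
≥ 3 and Vol > 8π²/9; RecognitionBeyondWeylGap gives Φ : M ≃ₘ S⁴; the round metric pulled back -/
@[route_item "route-SmoothPoincare4-RicciFat", crux]
def RicciFatSphereOfWeylGap : Prop :=
  RecognitionBeyondWeylGap → FatBeyondWeylGap → RicciFatSphere

/-- item stmt-SmoothPoincare4-5193 · support · rank 9 · closed · proved by Summit.SmoothPoincare4.SmoothPoincare4.Theorems.spc4ImpliesRicciFatSphere_proof (prover) · by planner
sources: CheegerColding1997, Literature.Geometry.Riemannian.ricci_roundMetric, Literature.Geometry.Lorentzian.riemannianMeasure_eq_integral_sqrt_det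
[support] consistency / normalisation check: SmoothPoincare4 → RicciFatSphere (pull the round metric
back along the diffeomorphism: Ric = 3g, Vol = 8π²/3 under `riemannianMeasure`; uses the tree's
`roundMetric`, the named fact `ricci_roundMetric` and the chart formula
`riemannianMeasure_eq_integral_sqrt_det_holds`). [difficulty: L] -/
@[route_item "route-SmoothPoincare4-RicciFat"]
def Spc4ImpliesRicciFatSphere : Prop :=
  SmoothPoincare4 → RicciFatSphere

/-- item stmt-SmoothPoincare4-18082 · support · rank 10 · open · by planner
sources: CheegerColding1997, App. 1 Thm A.1.10 and the proof sentence before it (p. 459), Colding1996Shape, Main Theorem, Summits/SmoothPoincare4/SmoothPoincare4/Cruxes/VolumeSphereRecognition/Lines/birth.lean (VolumeSphereRecognition_of, stub_coldingVolumeShapeFour)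
[support] [glue] HIERARCHICAL-CONE EDGE FOR THE PROMOTED CRUX (route-choice 2026-08-17):
SphereStabilityFour → ⟨Colding 1996, *Shape of manifolds with positive Ricci curvature*, Main
Theorem at n = 4: for every ε > 0 there is δ > 0 such that a compact connected C^∞ Riemannian
4-manifold with Ric ≥ 3 and Vol ≥ (1−δ)·8π²/3 admits an ε-Gromov–Hausdorff approximation to the
round S⁴ — spelled INLINE, verbatim the registered stub stub_coldingVolumeShapeFour of line `birth`,
which stays a stub of crux #2 (= n = 4 instance of the Literature fact Colding1996_volume_ghClose,
not judged apex; bridge coldingVolumeShapeFour_of_fact proved in the line)⟩ →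
VolumeSphereRecognition. This IS the printed one-sentence proof of Cheeger–Colding 1997 Thm A.1.10
at n = 4 (p. 459: take ε from sphere stability, δ = δ(ε) from Colding, Ric ≥ 3h ≥ −3h since h ≥ 0),
i.e. the kernel-checked composition VolumeSphereRecognition_of of Lines/birth.lean with its two
stubs as hypotheses. PROVABLE NOW — PROVED sorry-free in the planner's Sketch.lean (theorem
volumeSphereRecognitionOfStability_proof, 12 lines, lean check rc 0, axioms propext /
Classical.choice / Quot.sound); a prover lands it verbatim as Theorems/Ricci -/
@[route_item "route-SmoothPoincare4-RicciFat"]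
def VolumeSphereRecognitionOfStability : Prop :=
  SphereStabilityFour → (∀ ε : ℝ, 0 < ε → ∃ δ : ℝ, 0 < δ ∧ ∀ (M : Type) [TopologicalSpace M] [T2Space M] [SecondCountableTopology M] [ChartedSpace (EuclideanSpace ℝ (Fin 4)) M] [IsManifold (𝓡 4) ∞ M] [CompactSpace M] [ConnectedSpace M] [MeasurableSpace M] [BorelSpace M] (h : Bundle.ContMDiffRiemannianMetric (𝓡 4) ∞ (EuclideanSpace ℝ (Fin 4)) (TangentSpace (𝓡 4) : M → Type _)) [(Literature.Geometry.Lorentzian.PseudoRiemannianMetric.ofRiemannian h).HasLeviCivita], (∀ (x : M) (v : TangentSpace (𝓡 4) x), 3 * h.inner x v v ≤ (Literature.Geometry.Lorentzian.PseudoRiemannianMetric.ofRiemannian h).ricci x v v) → ENNReal.ofReal ((1 - δ) * (8 * Real.pi ^ 2 / 3)) ≤ Literature.Geometry.Lorentzian.riemannianMeasure h Set.univ → ∃ f : M → Metric.sphere (0 : EuclideanSpace ℝ (Fin 5)) 1, Literature.Geometry.Riemannian.IsRoundSphereGHApprox 4 h ε f) → VolumeSphereRecognition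

/-- item stmt-SmoothPoincare4-5194 · assembly · rank 1 · open · by planner
sources: CheegerColding1997, Kirby1997
[assembly] VolumeSphereRecognition → RicciFatSphere → SmoothPoincare4. -/
@[route_item "route-SmoothPoincare4-RicciFat"]
def Assembly : Prop :=
  VolumeSphereRecognition → RicciFatSphere → SmoothPoincare4

/-! D-0027 §2.1 — DECIDING THEOREM (planner-authored via `route open/edit --closes-file`; by planner-cstrat-stmt-SmoothPoincare4-5192-r1-0 2026-08-17T07:19:31Z):
its hypotheses are this route's items and its conclusion the sub-problem Statement (glue_lint), and it elaborates with this file. -/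

@[closes "route-SmoothPoincare4-RicciFat"] theorem closes (hRec : VolumeSphereRecognition)
    (hR : RecognitionBeyondWeylGap) (hF : FatBeyondWeylGap) (hGlue : RicciFatSphereOfWeylGap) :
    _root_.SmoothPoincare4 := by
  -- the Weyl-gap split assembles route RicciFat's thesis X = RicciFatSphere …
  have hFat : RicciFatSphere := hGlue hR hF
  -- … and Cheeger–Colding's volume sphere theorem turns X into SPC4
  unfold _root_.SmoothPoincare4 Literature.SPC4.SmoothPoincareConjectureFour
    ContinuousMap.HomotopyEquiv.NonemptyDiffeomorphSphere
  intro M _ _ _ _ _ e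
  haveI : CompactSpace M :=
    Literature.Topology.FourManifolds.compactSpace_of_homotopyEquiv_sphere_four_holds M e
  haveI : PathConnectedSpace (Metric.sphere (0 : EuclideanSpace ℝ (Fin 5)) 1) :=
    Literature.Topology.FourManifolds.pathConnectedSpace_sphere_four
  haveI : PathConnectedSpace M :=
    Literature.Topology.FourManifolds.pathConnectedSpace_of_homotopyEquiv e
  letI : MeasurableSpace M := borel M
  haveI : BorelSpace M := ⟨rfl⟩
  obtain ⟨δ, hδ, hrec⟩ := hRec
  obtain ⟨h, hLC, hRic, hVol⟩ := hFat M e δ hδ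
  haveI := hLC
  exact hrec M h hRic hVol

end Summit.SmoothPoincare4.SmoothPoincare4.Theses.RicciFat
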